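import Literature.NumberTheory.LFunctions.ConreyIwaniec2002Prop91Large
import HarnessLib

/-!
# Conrey–Iwaniec (2002), Proposition 9.1 (`_large` range) from Proposition 8.1 (`_large`) and Corollary 6.3 in the LARGE RANGE `X ≥ q²`

Companion of `ConreyIwaniec2002Prop91Large.lean` (cell landau-siegel/ls-inputs, line
`prop81-moebius-perron`, I6b) for line `smoothed-mellin-large` (I6c): the SAME kernel composition
with the typed Corollary 6.3 (`conreyIwaniec2002_corollary63`, remainder `(q/X)^{1/2}` for all
`X ≥ 1` — unproved, deep) replaced by its large-range sibling (remainder `√q · X^{-9/20}` for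
`X ≥ q²`, PROVED in `ConreyIwaniec2002Corollary63Large.lean`). The only consumer window is
`X = q² + 1`, `Y = q⁴` (the tree's `coeff_sums_le`), where the new remainder is
`r = √q (q²+1)^{-9/20} ≤ q^{-2/5}`; it is absorbed by re-splitting the tree's `remainder_absorb` at
`log T · √r = (log q)²` using only `r⁵ q² ≤ 1` and the effective `L(1,χ)² q ≥ 1`
(`remainder_absorb'`: case `log T·√r ≤ (log q)²` by `T(log q)⁶`; else
`(log q)³ r ≤ L(1,χ)² (log T)³` gives the second term of (9.7)). Everything else is the tree's text
verbatim with the one hypothesis swapped (`offdiagonal_term_le'`, `prop91_algebra'`, `coeff_sums_le'`,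
`prop91_large_of'`). Result: `prop91_large_of_prop81_large_corollary63_large` — stub S4 of SKELETON
I6c (sha16 47970a6266d02b83), conclusion VERBATIM the `h1` of `principalEstimate_of`.

«The programme SEARCHES and TYPES; no claim about Landau–Siegel zeros, Theorems 1–2 of
arXiv:2211.02515 or a repaired Margin232 until a kernel theorem says so.»

## References
* [ConreyIwaniec2002] B. Conrey, H. Iwaniec, Acta Arith. 103 (2002) 259–312, §9 p. 20,
  Proposition 9.1 (9.7); §6 Corollary 6.3 (6.49).
-/

noncomputable section

open scoped NumberField
open Complex

namespace Literature.NumberTheory.LFunctions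

namespace ConreyIwaniec2002

open NumberField

/-! ### The re-split absorption of the remainder -/

/-- `√(x + y) ≤ √x + √y`. [folklore] -/
private theorem sqrt_add_le_sqrt_add_sqrt {x y : ℝ} (hx : 0 ≤ x) (hy : 0 ≤ y) :
    Real.sqrt (x + y) ≤ Real.sqrt x + Real.sqrt y := by
  have hsx := Real.sqrt_nonneg x
  have hsy := Real.sqrt_nonneg y
  have h : x + y ≤ (Real.sqrt x + Real.sqrt y) ^ 2 := by
    rw [add_sq, Real.sq_sqrt hx, Real.sq_sqrt hy]
    nlinarith [mul_nonneg hsx hsy]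
  calc Real.sqrt (x + y) ≤ Real.sqrt ((Real.sqrt x + Real.sqrt y) ^ 2) := Real.sqrt_le_sqrt h
    _ = Real.sqrt x + Real.sqrt y := Real.sqrt_sq (by positivity)

/-- **The large-range remainder is absorbed effectively.** With `ℓ = log q ≥ 1`, `ℓ² ≤ LT = log T`,
`L1 = L(1,χ)` with `L1² q ≥ 1`, a remainder `r ≥ 0` with `r⁵ q² ≤ 1` (e.g. `r = √q (q²+1)^{-9/20}`) and
`L1² LT ≤ ℒ(T)`: `T·LT·ℓ⁴·√r ≤ Tℓ⁶ + T ℒ(T)^{1/2} LT² ℓ^{5/2}` — by `Tℓ⁶` when `LT √r ≤ ℓ²`, by the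
second term otherwise (then `ℓ³ r ≤ L1² LT³`, using `√r⁵ ≤ L1²`).
[cite: ConreyIwaniec2002, §9 p. 20 (use of (6.49))] -/
theorem remainder_absorb' {T LT ℓ L1 q r cLT : ℝ} (hT : 0 ≤ T) (hℓ : 1 ≤ ℓ) (hℓLT : ℓ ^ 2 ≤ LT)
    (hL1 : 0 ≤ L1) (hq : 0 < q) (hL1q : 1 ≤ L1 ^ 2 * q) (hr : 0 ≤ r) (hrq : r ^ 5 * q ^ 2 ≤ 1)
    (hcLT : L1 ^ 2 * LT ≤ cLT) :
    T * LT * ℓ ^ 4 * Real.sqrt r ≤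
      T * ℓ ^ 6 + T * Real.sqrt cLT * LT ^ 2 * ℓ ^ ((5 : ℝ) / 2) := by
  set s : ℝ := Real.sqrt r with hs
  have hs0 : 0 ≤ s := Real.sqrt_nonneg r
  have hs2 : s ^ 2 = r := Real.sq_sqrt hr
  have hℓ0 : 0 < ℓ := by linarith
  have hLT1 : 1 ≤ LT := le_trans (by nlinarith) hℓLT
  have hLT0 : 0 < LT := by linarith
  have hP0 : 0 ≤ T * ℓ ^ 6 := by positivity
  have hcLT0 : 0 ≤ cLT := le_trans (by positivity) hcLT
  have hQ0 : 0 ≤ T * Real.sqrt cLT * LT ^ 2 * ℓ ^ ((5 : ℝ) / 2) := by positivity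
  -- `ℓ²√ℓ = ℓ^{5/2}` and `L1 √LT ≤ √ℒ(T)`
  have hℓ52 : ℓ ^ 2 * Real.sqrt ℓ = ℓ ^ ((5 : ℝ) / 2) := by
    rw [Real.sqrt_eq_rpow, show ℓ ^ 2 = ℓ ^ ((2 : ℕ) : ℝ) from (Real.rpow_natCast ℓ 2).symm,
      ← Real.rpow_add hℓ0]
    norm_num
  have hL1sq : L1 * Real.sqrt LT ≤ Real.sqrt cLT := by
    have h1 : L1 * Real.sqrt LT = Real.sqrt (L1 ^ 2 * LT) := by
      rw [Real.sqrt_mul (by positivity), Real.sqrt_sq hL1]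
    rw [h1]
    exact Real.sqrt_le_sqrt hcLT
  -- `s⁵ ≤ L1²` from `s¹⁰ q² = r⁵ q² ≤ 1 ≤ (L1² q)²`
  have hs5 : s ^ 5 ≤ L1 ^ 2 := by
    have h1 : (s ^ 5) ^ 2 * q ^ 2 ≤ (L1 ^ 2) ^ 2 * q ^ 2 := by
      calc (s ^ 5) ^ 2 * q ^ 2 = r ^ 5 * q ^ 2 := by rw [← hs2]; ring
        _ ≤ 1 := hrq
        _ ≤ (L1 ^ 2 * q) ^ 2 := one_le_pow₀ hL1q
        _ = (L1 ^ 2) ^ 2 * q ^ 2 := by ring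
    have h2 : (s ^ 5) ^ 2 ≤ (L1 ^ 2) ^ 2 := le_of_mul_le_mul_right h1 (by positivity)
    exact (pow_le_pow_iff_left₀ (by positivity) (by positivity) (by norm_num : (2 : ℕ) ≠ 0)).mp h2
  by_cases hcase : LT * s ≤ ℓ ^ 2
  · -- case A: the remainder is `≤ Tℓ⁶`
    calc T * LT * ℓ ^ 4 * s = T * ℓ ^ 4 * (LT * s) := by ring
      _ ≤ T * ℓ ^ 4 * ℓ ^ 2 := by gcongr
      _ = T * ℓ ^ 6 := by ring
      _ ≤ T * ℓ ^ 6 + T * Real.sqrt cLT * LT ^ 2 * ℓ ^ ((5 : ℝ) / 2) := le_add_of_nonneg_right hQ0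
  · -- case B: `ℓ² < LT s`; then `ℓ³ s² ≤ L1² LT³`, i.e. `ℓ^{3/2} s ≤ L1 LT^{3/2}`
    push Not at hcase
    have hspos : 0 < s := by
      rcases lt_or_eq_of_le hs0 with h | h
      · exact h
      · rw [← h, mul_zero] at hcase; nlinarith
    have key : ℓ ^ 3 * s ^ 2 ≤ L1 ^ 2 * LT ^ 3 := by
      have h1 : ℓ ^ 6 ≤ LT ^ 3 * s ^ 3 := by
        have := pow_le_pow_left₀ (by positivity) hcase.le 3
        calc ℓ ^ 6 = (ℓ ^ 2) ^ 3 := by ring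
          _ ≤ (LT * s) ^ 3 := this
          _ = LT ^ 3 * s ^ 3 := by ring
      have hℓ36 : ℓ ^ 3 ≤ ℓ ^ 6 := pow_le_pow_right₀ hℓ (by norm_num)
      have h2 : ℓ ^ 3 * s ^ 5 ≤ L1 ^ 2 * LT ^ 3 * s ^ 3 := by
        calc ℓ ^ 3 * s ^ 5 ≤ ℓ ^ 3 * L1 ^ 2 := by gcongr
          _ ≤ ℓ ^ 6 * L1 ^ 2 := by gcongr
          _ ≤ (LT ^ 3 * s ^ 3) * L1 ^ 2 := by gcongr
          _ = L1 ^ 2 * LT ^ 3 * s ^ 3 := by ring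
      have h3 : (ℓ ^ 3 * s ^ 2) * s ^ 3 ≤ (L1 ^ 2 * LT ^ 3) * s ^ 3 := by
        calc (ℓ ^ 3 * s ^ 2) * s ^ 3 = ℓ ^ 3 * s ^ 5 := by ring
          _ ≤ L1 ^ 2 * LT ^ 3 * s ^ 3 := h2
      exact le_of_mul_le_mul_right h3 (by positivity)
    set u : ℝ := ℓ * Real.sqrt ℓ * s with hu
    set v : ℝ := L1 * LT * Real.sqrt LT with hv
    have hu0 : 0 ≤ u := by positivity
    have hv0 : 0 ≤ v := by positivity
    have hsℓ : Real.sqrt ℓ ^ 2 = ℓ := Real.sq_sqrt hℓ0.le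
    have hsLT : Real.sqrt LT ^ 2 = LT := Real.sq_sqrt hLT0.le
    have huv2 : u ^ 2 ≤ v ^ 2 := by
      have eu : u ^ 2 = ℓ ^ 3 * s ^ 2 := by
        rw [hu, mul_pow, mul_pow, hsℓ]; ring
      have ev : v ^ 2 = L1 ^ 2 * LT ^ 3 := by
        rw [hv, mul_pow, mul_pow, hsLT]; ring
      rw [eu, ev]; exact key
    have huv : u ≤ v :=
      (pow_le_pow_iff_left₀ hu0 hv0 (by norm_num : (2 : ℕ) ≠ 0)).mp huv2
    have hℓ4 : ℓ ^ 4 * s = ℓ ^ 2 * Real.sqrt ℓ * u := by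
      rw [hu]
      have : Real.sqrt ℓ * Real.sqrt ℓ = ℓ := Real.mul_self_sqrt hℓ0.le
      calc ℓ ^ 4 * s = ℓ ^ 3 * (Real.sqrt ℓ * Real.sqrt ℓ) * s := by rw [this]; ring
        _ = ℓ ^ 2 * Real.sqrt ℓ * (ℓ * Real.sqrt ℓ * s) := by ring
    calc T * LT * ℓ ^ 4 * s = T * LT * (ℓ ^ 2 * Real.sqrt ℓ) * u := by rw [mul_assoc (T * LT), hℓ4]; ring
      _ ≤ T * LT * (ℓ ^ 2 * Real.sqrt ℓ) * v := by gcongr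
      _ = T * (L1 * Real.sqrt LT) * LT ^ 2 * (ℓ ^ 2 * Real.sqrt ℓ) := by rw [hv]; ring
      _ ≤ T * Real.sqrt cLT * LT ^ 2 * ℓ ^ ((5 : ℝ) / 2) := by rw [← hℓ52]; gcongr
      _ ≤ T * ℓ ^ 6 + T * Real.sqrt cLT * LT ^ 2 * ℓ ^ ((5 : ℝ) / 2) := le_add_of_nonneg_left hP0

/-! ### The tree's algebra with the swapped remainder hypothesis -/

/-- **The off-diagonal terms**: from the separated bilinear bounds for `B₁, B₂`, the coefficient
sums (`(1+4ℓ)⁴` and `C₅(8ℒ(q)ℓ + r)`), `|x| ≤ 3C₃ LT`, `ℒ(q) ≤ ℒ(T)` and `ℓ² ≤ LT`: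
`(sup|x|)·Σ_s(|B₁|+|B₂|) ≤ 15000 C₃C₄√C₅ (Tℓ⁶ + Tℒ(T)^{1/2}LT²ℓ^{5/2})` — the honest form of the
printed `(log T)Σ_s|B(s)| ≪ Tℒ(q)^{1/2}(log T)(log q)^{9/2}` (FLAG 2: needs `(log q)² ≤ log T`) plus the
remainder `r` with `r⁵q² ≤ 1` (`remainder_absorb'`); verbatim the tree's `offdiagonal_term_le` otherwise. [cite: ConreyIwaniec2002, §9 p. 20 L18–38] -/
theorem offdiagonal_term_le' {C₃ C₄ C₅ T LT ℓ L1 q r cLT cLq XB SB₁ SB₂ A₁ Bn₁ A₂ Bn₂ : ℝ}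
    (hC₃ : 0 < C₃) (hC₄ : 0 < C₄) (hC₅ : 0 < C₅) (hT : 0 ≤ T) (hℓ : 1 ≤ ℓ) (hℓLT : ℓ ^ 2 ≤ LT)
    (hL1 : 0 ≤ L1) (hq : 0 < q) (hL1q : 1 ≤ L1 ^ 2 * q) (hr : 0 ≤ r) (hrq : r ^ 5 * q ^ 2 ≤ 1)
    (hcLq0 : 0 ≤ cLq) (hcLq : cLq ≤ cLT) (hcLT : L1 ^ 2 * LT ≤ cLT)
    (hXB : XB ≤ 3 * C₃ * LT) (hSB₁0 : 0 ≤ SB₁) (hSB₂0 : 0 ≤ SB₂)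
    (hSB₁ : SB₁ ≤ C₄ * T * (1 + 4 * ℓ) * (1 + 4 * ℓ) * Real.sqrt A₁ * Real.sqrt Bn₁)
    (hSB₂ : SB₂ ≤ C₄ * T * (1 + 4 * ℓ) * (1 + 4 * ℓ) * Real.sqrt A₂ * Real.sqrt Bn₂)
    (hA₁ : A₁ ≤ C₅ * (8 * cLq * ℓ + r)) (hBn₁ : Bn₁ ≤ (1 + 4 * ℓ) ^ 4)
    (hA₂ : A₂ ≤ (1 + 4 * ℓ) ^ 4) (hBn₂ : Bn₂ ≤ C₅ * (8 * cLq * ℓ + r)) :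
    XB * (SB₁ + SB₂) ≤
      15000 * C₃ * C₄ * Real.sqrt C₅ *
        (T * ℓ ^ 6 + T * Real.sqrt cLT * LT ^ 2 * ℓ ^ ((5 : ℝ) / 2)) := by
  have hℓ0 : 0 < ℓ := by linarith
  have hℓ1 : (1 : ℝ) ≤ ℓ ^ 2 := one_le_pow₀ hℓ
  have hLT1 : 1 ≤ LT := hℓ1.trans hℓLT
  have hLT0 : 0 ≤ LT := by linarith
  have hcLT0 : 0 ≤ cLT := hcLq0.trans hcLq
  set s : ℝ := Real.sqrt r with hs
  set P : ℝ := T * ℓ ^ 6 with hP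
  set Q : ℝ := T * Real.sqrt cLT * LT ^ 2 * ℓ ^ ((5 : ℝ) / 2) with hQ
  have hP0 : 0 ≤ P := by positivity
  have hQ0 : 0 ≤ Q := by positivity
  have hs0 : 0 ≤ s := Real.sqrt_nonneg r
  -- the small square root: `√(C₅(8ℒ(q)ℓ + r)) ≤ √C₅ (3√(ℒ(T)ℓ) + s) =: W`
  set W : ℝ := Real.sqrt C₅ * (3 * Real.sqrt (cLT * ℓ) + s) with hWdef
  have hW0 : 0 ≤ W := by positivity
  have hW : Real.sqrt (C₅ * (8 * cLq * ℓ + r)) ≤ W := by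
    rw [hWdef, Real.sqrt_mul hC₅.le]
    refine mul_le_mul_of_nonneg_left ?_ (Real.sqrt_nonneg _)
    have h89 : 8 * cLq * ℓ ≤ 9 * (cLT * ℓ) := by
      have := mul_le_mul_of_nonneg_right hcLq hℓ0.le
      nlinarith [mul_nonneg hcLq0 hℓ0.le]
    have h9 : Real.sqrt (9 * (cLT * ℓ)) = 3 * Real.sqrt (cLT * ℓ) := by
      rw [Real.sqrt_mul (by norm_num), show (9 : ℝ) = 3 ^ 2 by norm_num,
        Real.sqrt_sq (by norm_num)]
    calc Real.sqrt (8 * cLq * ℓ + r) ≤ Real.sqrt (8 * cLq * ℓ) + Real.sqrt r :=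
          sqrt_add_le_sqrt_add_sqrt (by positivity) hr
      _ ≤ Real.sqrt (9 * (cLT * ℓ)) + s := add_le_add (Real.sqrt_le_sqrt h89) le_rfl
      _ = 3 * Real.sqrt (cLT * ℓ) + s := by rw [h9]
  -- the large square root: `√((1+4ℓ)⁴) = (1+4ℓ)² ≤ 25ℓ²`
  have h14 : 1 + 4 * ℓ ≤ 5 * ℓ := by linarith
  have h140 : 0 ≤ 1 + 4 * ℓ := by positivity
  have hV : Real.sqrt ((1 + 4 * ℓ) ^ 4) ≤ 25 * ℓ ^ 2 := by
    rw [show (1 + 4 * ℓ) ^ 4 = ((1 + 4 * ℓ) ^ 2) ^ 2 by ring, Real.sqrt_sq (by positivity)]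
    calc (1 + 4 * ℓ) ^ 2 ≤ (5 * ℓ) ^ 2 := pow_le_pow_left₀ h140 h14 2
      _ = 25 * ℓ ^ 2 := by ring
  -- each `SB_i ≤ 625 C₄ T ℓ⁴ W`
  have hA₁' : Real.sqrt A₁ ≤ W := (Real.sqrt_le_sqrt hA₁).trans hW
  have hBn₁' : Real.sqrt Bn₁ ≤ 25 * ℓ ^ 2 := (Real.sqrt_le_sqrt hBn₁).trans hV
  have hA₂' : Real.sqrt A₂ ≤ 25 * ℓ ^ 2 := (Real.sqrt_le_sqrt hA₂).trans hV
  have hBn₂' : Real.sqrt Bn₂ ≤ W := (Real.sqrt_le_sqrt hBn₂).trans hW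
  have hC₄T : 0 ≤ C₄ * T := by positivity
  have hSB₁' : SB₁ ≤ 625 * C₄ * T * ℓ ^ 4 * W := by
    calc SB₁ ≤ C₄ * T * (1 + 4 * ℓ) * (1 + 4 * ℓ) * Real.sqrt A₁ * Real.sqrt Bn₁ := hSB₁
      _ ≤ C₄ * T * (5 * ℓ) * (5 * ℓ) * W * (25 * ℓ ^ 2) := by gcongr
      _ = 625 * C₄ * T * ℓ ^ 4 * W := by ring
  have hSB₂' : SB₂ ≤ 625 * C₄ * T * ℓ ^ 4 * W := by
    calc SB₂ ≤ C₄ * T * (1 + 4 * ℓ) * (1 + 4 * ℓ) * Real.sqrt A₂ * Real.sqrt Bn₂ := hSB₂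
      _ ≤ C₄ * T * (5 * ℓ) * (5 * ℓ) * (25 * ℓ ^ 2) * W := by gcongr
      _ = 625 * C₄ * T * ℓ ^ 4 * W := by ring
  -- multiply by `|x| ≤ 3C₃LT`
  have hprod : XB * (SB₁ + SB₂) ≤ (3 * C₃ * LT) * (1250 * C₄ * T * ℓ ^ 4 * W) := by
    have h12 : SB₁ + SB₂ ≤ 1250 * C₄ * T * ℓ ^ 4 * W := by linarith
    have h120 : 0 ≤ SB₁ + SB₂ := by positivity
    exact mul_le_mul hXB h12 h120 (by positivity)
  -- (a) `T·LT·ℓ⁴·√(ℒ(T)ℓ) ≤ Q` by `ℓ² ≤ LT`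
  have hℓ52 : Real.sqrt ℓ * ℓ ^ 2 = ℓ ^ ((5 : ℝ) / 2) := by
    rw [Real.sqrt_eq_rpow, show ℓ ^ 2 = ℓ ^ ((2 : ℕ) : ℝ) from (Real.rpow_natCast ℓ 2).symm,
      ← Real.rpow_add hℓ0]
    norm_num
  have ha : T * LT * ℓ ^ 4 * Real.sqrt (cLT * ℓ) ≤ Q := by
    rw [Real.sqrt_mul hcLT0]
    have hsc : 0 ≤ T * Real.sqrt cLT := by positivity
    have hsl : 0 ≤ Real.sqrt ℓ * ℓ ^ 2 := by positivity
    calc T * LT * ℓ ^ 4 * (Real.sqrt cLT * Real.sqrt ℓ)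
        = T * Real.sqrt cLT * (LT * ℓ ^ 2) * (Real.sqrt ℓ * ℓ ^ 2) := by ring
      _ ≤ T * Real.sqrt cLT * (LT * LT) * (Real.sqrt ℓ * ℓ ^ 2) := by
          apply mul_le_mul_of_nonneg_right _ hsl
          apply mul_le_mul_of_nonneg_left _ hsc
          exact mul_le_mul_of_nonneg_left hℓLT hLT0
      _ = Q := by rw [hℓ52, hQ]; ring
  -- (b) the remainder
  have hb : T * LT * ℓ ^ 4 * s ≤ P + Q :=
    remainder_absorb' hT hℓ hℓLT hL1 hq hL1q hr hrq hcLT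
  -- assemble
  set K₀ : ℝ := 3750 * C₃ * C₄ * Real.sqrt C₅ with hK₀
  have hK0 : 0 ≤ K₀ := by positivity
  have hexp : (3 * C₃ * LT) * (1250 * C₄ * T * ℓ ^ 4 * W) =
      K₀ * (3 * (T * LT * ℓ ^ 4 * Real.sqrt (cLT * ℓ)) + T * LT * ℓ ^ 4 * s) := by
    rw [hWdef, hK₀]; ring
  have hin : 3 * (T * LT * ℓ ^ 4 * Real.sqrt (cLT * ℓ)) + T * LT * ℓ ^ 4 * s ≤
      3 * Q + (P + Q) := by linarith
  have hKP : 0 ≤ K₀ * P := mul_nonneg hK0 hP0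
  calc XB * (SB₁ + SB₂) ≤ (3 * C₃ * LT) * (1250 * C₄ * T * ℓ ^ 4 * W) := hprod
    _ = K₀ * (3 * (T * LT * ℓ ^ 4 * Real.sqrt (cLT * ℓ)) + T * LT * ℓ ^ 4 * s) := hexp
    _ ≤ K₀ * (3 * Q + (P + Q)) := mul_le_mul_of_nonneg_left hin hK0
    _ = 4 * K₀ * (P + Q) - 3 * (K₀ * P) := by ring
    _ ≤ 4 * K₀ * (P + Q) := by linarith
    _ = 15000 * C₃ * C₄ * Real.sqrt C₅ *
        (T * ℓ ^ 6 + T * Real.sqrt cLT * LT ^ 2 * ℓ ^ ((5 : ℝ) / 2)) := by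
        rw [hK₀, hP, hQ]; ring

/-- **The arithmetic of Proposition 9.1** (pure real algebra, isolated so that the composition
elaborates quickly): `E ≤ D^{1/2}(Σ|M|²)^{1/2} + (sup|x|)Σ(|B₁|+|B₂|)` together with Proposition 8.1,
the mean square of `M`, the separated bilinear bounds, the coefficient sums, Corollary 6.3 and
`L(1,χ) ≥ π/√q` give (9.7) with `C₀ = √(C₁C₂) + 15000 C₃C₄√C₅`; remainder hypothesis `r⁵q² ≤ 1` (verbatim the tree's `prop91_algebra` otherwise).
[cite: ConreyIwaniec2002, Proposition 9.1 (9.7)] -/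
theorem prop91_algebra' {C₁ C₂ C₃ C₄ C₅ T LT ℓ L1 q r cLT cLq D SM E XB SB₁ SB₂ A₁ Bn₁ A₂ Bn₂ : ℝ}
    (hC₁ : 0 < C₁) (hC₂ : 0 < C₂) (hC₃ : 0 < C₃) (hC₄ : 0 < C₄) (hC₅ : 0 < C₅)
    (hT : 0 ≤ T) (hℓ : 1 ≤ ℓ) (hℓLT : ℓ ^ 2 ≤ LT)
    (hL1 : 0 ≤ L1) (hq : 0 < q) (hL1q : 1 ≤ L1 ^ 2 * q) (hr : 0 ≤ r) (hrq : r ^ 5 * q ^ 2 ≤ 1)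
    (hcLq0 : 0 ≤ cLq) (hcLq : cLq ≤ cLT) (hcLT : L1 ^ 2 * LT ≤ cLT)
    (hE : E ≤ Real.sqrt D * Real.sqrt SM + XB * (SB₁ + SB₂))
    (hD : D ≤ C₁ * (T * ℓ ^ 7 + T * cLT * LT ^ 4)) (hSM : SM ≤ C₂ * (T * ℓ ^ 5))
    (hXB : XB ≤ 3 * C₃ * LT) (hSB₁0 : 0 ≤ SB₁) (hSB₂0 : 0 ≤ SB₂)
    (hSB₁ : SB₁ ≤ C₄ * T * (1 + 4 * ℓ) * (1 + 4 * ℓ) * Real.sqrt A₁ * Real.sqrt Bn₁)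
    (hSB₂ : SB₂ ≤ C₄ * T * (1 + 4 * ℓ) * (1 + 4 * ℓ) * Real.sqrt A₂ * Real.sqrt Bn₂)
    (hA₁ : A₁ ≤ C₅ * (8 * cLq * ℓ + r)) (hBn₁ : Bn₁ ≤ (1 + 4 * ℓ) ^ 4)
    (hA₂ : A₂ ≤ (1 + 4 * ℓ) ^ 4) (hBn₂ : Bn₂ ≤ C₅ * (8 * cLq * ℓ + r)) :
    E ≤ (Real.sqrt (C₁ * C₂) + 15000 * C₃ * C₄ * Real.sqrt C₅) *
      (T * ℓ ^ (6 : ℕ) + T * Real.sqrt cLT * LT ^ (2 : ℕ) * ℓ ^ ((5 : ℝ) / 2)) := by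
  have hcLT0 : 0 ≤ cLT := hcLq0.trans hcLq
  have h1 := diagonal_term_le hC₁ hC₂ hT (by linarith) hcLT0 hD hSM
  have h2 := offdiagonal_term_le' hC₃ hC₄ hC₅ hT hℓ hℓLT hL1 hq hL1q hr hrq hcLq0 hcLq hcLT hXB
    hSB₁0 hSB₂0 hSB₁ hSB₂ hA₁ hBn₁ hA₂ hBn₂
  calc E ≤ Real.sqrt D * Real.sqrt SM + XB * (SB₁ + SB₂) := hE
    _ ≤ _ := by rw [add_mul]; exact add_le_add h1 h2

/-! ### The coefficient sums from Corollary 6.3 in the large range -/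

/-- **Coefficient sums, I**: `Σ_{n∈[a,b]} |c(n)|²/n ≤ Σ_{n∈[a,b]} |d(n)|²/n` from `|c(n)| ≤ |d(n)|`
termwise (`n ≥ 1`). [folklore] -/
private theorem sum_norm_sq_div_le_of_le {c d : ℕ → ℂ} {a b : ℕ}
    (h : ∀ n, n ≠ 0 → ‖c n‖ ≤ ‖d n‖) (ha : 1 ≤ a) :
    ∑ n ∈ Finset.Icc a b, ‖c n‖ ^ 2 / n ≤ ∑ n ∈ Finset.Icc a b, ‖d n‖ ^ 2 / n := by
  refine Finset.sum_le_sum fun n hn => ?_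
  rw [Finset.mem_Icc] at hn
  have hn0 : n ≠ 0 := by omega
  exact div_le_div_of_nonneg_right (pow_le_pow_left₀ (norm_nonneg _) (h n hn0) 2) (Nat.cast_nonneg n)

/-- The large-range remainder at the consumer window `X = q²+1`: `r = √q (q²+1)^{-9/20}` has
`r⁵ q² = q^{9/2}(q²+1)^{-9/4} ≤ 1`. [cite: ConreyIwaniec2002, §9 p. 20 (use of (6.49))] -/
theorem rpow_remainder_le {q : ℕ} (hq : 0 < q) :
    (Real.sqrt q * ((q ^ 2 + 1 : ℕ) : ℝ) ^ (-(9 / 20 : ℝ))) ^ 5 * (q : ℝ) ^ 2 ≤ 1 := by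
  have hqpos : (0 : ℝ) < q := by exact_mod_cast hq
  set X₀ : ℝ := ((q ^ 2 + 1 : ℕ) : ℝ) with hX₀
  have hX : X₀ = (q : ℝ) ^ 2 + 1 := by rw [hX₀]; push_cast; ring
  have hX0pos : 0 < X₀ := by rw [hX]; positivity
  have hqX : (q : ℝ) ^ (2 : ℝ) ≤ X₀ := by rw [hX, Real.rpow_two]; linarith
  have h1 : (Real.sqrt q * X₀ ^ (-(9 / 20 : ℝ))) ^ 5 = (q : ℝ) ^ ((5 : ℝ) / 2) * X₀ ^ (-(9 / 4 : ℝ)) := by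
    rw [mul_pow, Real.sqrt_eq_rpow, ← Real.rpow_natCast ((q : ℝ) ^ ((1 : ℝ) / 2)) 5,
      ← Real.rpow_mul hqpos.le, ← Real.rpow_natCast (X₀ ^ (-(9 / 20 : ℝ))) 5,
      ← Real.rpow_mul hX0pos.le]
    norm_num
  have h2 : X₀ ^ (-(9 / 4 : ℝ)) ≤ ((q : ℝ) ^ (2 : ℝ)) ^ (-(9 / 4 : ℝ)) :=
    Real.rpow_le_rpow_of_nonpos (by positivity) hqX (by norm_num)
  have h3 : ((q : ℝ) ^ (2 : ℝ)) ^ (-(9 / 4 : ℝ)) = (q : ℝ) ^ (-(9 / 2 : ℝ)) := by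
    rw [← Real.rpow_mul hqpos.le]; norm_num
  have h4 : (q : ℝ) ^ 2 = (q : ℝ) ^ (2 : ℝ) := (Real.rpow_two _).symm
  rw [h1, h4]
  have h0 : 0 ≤ (q : ℝ) ^ ((5 : ℝ) / 2) := Real.rpow_nonneg hqpos.le _
  have h0' : 0 ≤ (q : ℝ) ^ (2 : ℝ) := Real.rpow_nonneg hqpos.le _
  calc (q : ℝ) ^ ((5 : ℝ) / 2) * X₀ ^ (-(9 / 4 : ℝ)) * (q : ℝ) ^ (2 : ℝ)
      ≤ (q : ℝ) ^ ((5 : ℝ) / 2) * ((q : ℝ) ^ (2 : ℝ)) ^ (-(9 / 4 : ℝ)) * (q : ℝ) ^ (2 : ℝ) := by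
        gcongr
    _ = 1 := by
        rw [h3, ← Real.rpow_add hqpos, ← Real.rpow_add hqpos]; norm_num

/-- **The four coefficient sums of p. 20** (`|λ*(m)|, |λ(n)| ≤ τ(·,χ) ≤ d(·)`, (9.4)):
`Σ_{q²<m≤q⁴}|λ*(m)|²/m`, `Σ_{q²<n≤q⁴}|λ(n)|²/n ≤ C₅(8ℒ(q)log q + (q/(q²+1))^{1/2})` (Corollary 6.3 at
`X = q²+1`, `Y = q⁴`, with `ℒ(q⁴) ≤ 4ℒ(q)`, `log(Y/X) ≤ 2 log q`), and
`Σ_{n≤q⁴}|λ(n)|²/n`, `Σ_{m≤q²}|λ*(m)|²/m ≤ (1 + 4 log q)⁴` (tree `sum_card_divisors_sq_div_le`).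
[cite: ConreyIwaniec2002, §9 p. 20 L14–36 and (9.4)] -/
theorem coeff_sums_le' {q : ℕ} [NeZero q] (hq : 4 < q) {χ : DirichletCharacter ℂ q}
    (K : Type) [Field K] [NumberField K] (ψ : ClassGroup (𝓞 K) →* ℂˣ)
    (hid : ∀ {n : ℕ}, n ≠ 0 → (idealNormCount K n : ℝ) = ‖divisorSumChar χ n‖)
    {C₅ : ℝ} (hC₅ : 0 < C₅)
    (h63 : ∀ X Y : ℝ, (q : ℝ) ^ 2 ≤ X → 2 * X ≤ Y →
      ∑ n ∈ Finset.Icc ⌈X⌉₊ ⌊Y⌋₊, ‖divisorSumChar χ n‖ ^ 2 / (n : ℝ) ≤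
        C₅ * (calL χ Y * Real.log (Y / X) + Real.sqrt q * X ^ (-(9 / 20 : ℝ)))) :
    (∑ m ∈ Finset.Icc (q ^ 2 + 1) (q ^ 4), ‖twistMoebius K (classGroupCharIdealHom ψ) m‖ ^ 2 / m ≤
        C₅ * (8 * calL χ q * Real.log q + (Real.sqrt q * ((q ^ 2 + 1 : ℕ) : ℝ) ^ (-(9 / 20 : ℝ))))) ∧
    (∑ n ∈ Finset.Icc 1 (q ^ 4), ‖twistCount K (classGroupCharIdealHom ψ) n‖ ^ 2 / n ≤
        (1 + 4 * Real.log q) ^ 4) ∧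
    (∑ m ∈ Finset.Icc 1 (q ^ 2), ‖twistMoebius K (classGroupCharIdealHom ψ) m‖ ^ 2 / m ≤
        (1 + 4 * Real.log q) ^ 4) ∧
    (∑ n ∈ Finset.Icc (q ^ 2 + 1) (q ^ 4), ‖twistCount K (classGroupCharIdealHom ψ) n‖ ^ 2 / n ≤
        C₅ * (8 * calL χ q * Real.log q + (Real.sqrt q * ((q ^ 2 + 1 : ℕ) : ℝ) ^ (-(9 / 20 : ℝ))))) ∧
    (Real.sqrt q * ((q ^ 2 + 1 : ℕ) : ℝ) ^ (-(9 / 20 : ℝ))) ^ 5 * (q : ℝ) ^ 2 ≤ 1 := by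
  have hq0 : 0 < q := by omega
  have hq5 : (5 : ℝ) ≤ q := by exact_mod_cast hq
  have hq1 : (1 : ℝ) ≤ q := by linarith
  have hqpos : (0 : ℝ) < q := by linarith
  have hℓ1 : 1 ≤ Real.log q := by
    rw [Real.le_log_iff_exp_le (by linarith)]
    exact Real.exp_one_lt_d9.le.trans (by linarith)
  have hℓ0 : 0 ≤ Real.log q := by linarith
  have hL1 : 0 ≤ ‖χ.LFunction 1‖ := norm_nonneg _
  have hd0 : 0 ≤ ‖deriv χ.LFunction 1‖ := norm_nonneg _
  have hν : ∀ I, ‖classGroupCharIdealHom ψ I‖ ≤ 1 := norm_classGroupCharIdealHom_le ψ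
  have hlog4 : Real.log ((q ^ 4 : ℕ) : ℝ) = 4 * Real.log q := by
    push_cast; rw [Real.log_pow]; push_cast; ring
  have hlog2 : Real.log ((q ^ 2 : ℕ) : ℝ) = 2 * Real.log q := by
    push_cast; rw [Real.log_pow]; push_cast; ring
  have hX : ((q ^ 2 + 1 : ℕ) : ℝ) = (q : ℝ) ^ 2 + 1 := by push_cast; ring
  have hY : ((q ^ 4 : ℕ) : ℝ) = (q : ℝ) ^ 4 := by push_cast; ring
  have hXpos : (0 : ℝ) < ((q ^ 2 + 1 : ℕ) : ℝ) := by positivity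
  have hq44 : (q : ℝ) ^ 4 = (q : ℝ) ^ 2 * (q : ℝ) ^ 2 := by ring
  have h25 : (25 : ℝ) ≤ (q : ℝ) ^ 2 := by nlinarith
  -- coefficient bounds `|λ|, |λ*| ≤ τ(·,χ) ≤ d(·)`
  have hcoefM : ∀ m, m ≠ 0 → ‖twistMoebius K (classGroupCharIdealHom ψ) m‖ ≤ ‖divisorSumChar χ m‖ :=
    fun m hm => (norm_twistMoebius_le hν m).trans (le_of_eq (hid hm))
  have hcoefN : ∀ n, n ≠ 0 → ‖twistCount K (classGroupCharIdealHom ψ) n‖ ≤ ‖divisorSumChar χ n‖ :=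
    fun n hn => (norm_twistCount_le hν n).trans (le_of_eq (hid hn))
  have hdivC : ∀ n, n ≠ 0 → ‖divisorSumChar χ n‖ ≤ ‖((n.divisors.card : ℝ) : ℂ)‖ := by
    intro n _
    rw [Complex.norm_real, Real.norm_eq_abs, abs_of_nonneg (Nat.cast_nonneg _)]
    exact norm_divisorSumChar_le χ n
  have hdivsum : ∀ N : ℕ, ∑ n ∈ Finset.Icc 1 N, ‖((n.divisors.card : ℝ) : ℂ)‖ ^ 2 / n ≤
      (1 + Real.log N) ^ 4 := by
    intro N
    have h := ZetaM4D.sum_card_divisors_sq_div_le N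
    refine le_trans (le_of_eq (Finset.sum_congr rfl fun n _ => ?_)) h
    rw [Complex.norm_real, Real.norm_eq_abs, abs_of_nonneg (Nat.cast_nonneg _)]
  -- Corollary 6.3 on `(q², q⁴]`
  have hX1 : (q : ℝ) ^ 2 ≤ ((q ^ 2 + 1 : ℕ) : ℝ) := by rw [hX]; linarith
  have hXY : 2 * ((q ^ 2 + 1 : ℕ) : ℝ) ≤ ((q ^ 4 : ℕ) : ℝ) := by
    rw [hX, hY, hq44]; nlinarith
  have h63' := h63 ((q ^ 2 + 1 : ℕ) : ℝ) ((q ^ 4 : ℕ) : ℝ) hX1 hXY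
  rw [Nat.ceil_natCast, Nat.floor_natCast] at h63'
  have hrq := rpow_remainder_le hq0
  have hmain63 : calL χ ((q ^ 4 : ℕ) : ℝ) * Real.log (((q ^ 4 : ℕ) : ℝ) / ((q ^ 2 + 1 : ℕ) : ℝ)) ≤
      8 * calL χ q * Real.log q := by
    have hcal : calL χ ((q ^ 4 : ℕ) : ℝ) ≤ 4 * calL χ q := by
      unfold calL
      rw [hlog4]
      nlinarith [mul_nonneg hL1 hd0, mul_nonneg hL1 (mul_nonneg hL1 hℓ0)]
    have hYX1 : (1 : ℝ) ≤ ((q ^ 4 : ℕ) : ℝ) / ((q ^ 2 + 1 : ℕ) : ℝ) := by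
      rw [le_div_iff₀ hXpos, hX, hY, hq44]; nlinarith
    have hYX : ((q ^ 4 : ℕ) : ℝ) / ((q ^ 2 + 1 : ℕ) : ℝ) ≤ (q : ℝ) ^ 2 := by
      rw [div_le_iff₀ hXpos, hX, hY, hq44]; nlinarith
    have hlog0 : 0 ≤ Real.log (((q ^ 4 : ℕ) : ℝ) / ((q ^ 2 + 1 : ℕ) : ℝ)) := Real.log_nonneg hYX1
    have hlogYX : Real.log (((q ^ 4 : ℕ) : ℝ) / ((q ^ 2 + 1 : ℕ) : ℝ)) ≤ 2 * Real.log q := by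
      calc _ ≤ Real.log ((q : ℝ) ^ 2) := Real.log_le_log (by positivity) hYX
        _ = 2 * Real.log q := by rw [Real.log_pow]; push_cast; ring
    have hcq0 : 0 ≤ calL χ q := calL_nonneg χ hq1
    calc _ ≤ (4 * calL χ q) * (2 * Real.log q) := mul_le_mul hcal hlogYX hlog0 (by positivity)
      _ = 8 * calL χ q * Real.log q := by ring
  have h63'' : ∑ n ∈ Finset.Icc (q ^ 2 + 1) (q ^ 4), ‖divisorSumChar χ n‖ ^ 2 / n ≤
      C₅ * (8 * calL χ q * Real.log q + (Real.sqrt q * ((q ^ 2 + 1 : ℕ) : ℝ) ^ (-(9 / 20 : ℝ)))) := by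
    refine h63'.trans ?_
    gcongr
  refine ⟨(sum_norm_sq_div_le_of_le hcoefM (Nat.le_add_left 1 _)).trans h63'', ?_, ?_,
    (sum_norm_sq_div_le_of_le hcoefN (Nat.le_add_left 1 _)).trans h63'', hrq⟩
  · have h := (sum_norm_sq_div_le_of_le (fun n hn => (hcoefN n hn).trans (hdivC n hn)) le_rfl).trans
      (hdivsum (q ^ 4))
    rwa [hlog4] at h
  · have h := (sum_norm_sq_div_le_of_le (fun n hn => (hcoefM n hn).trans (hdivC n hn)) le_rfl).trans
      (hdivsum (q ^ 2))
    rw [hlog2] at h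
    exact h.trans (pow_le_pow_left₀ (by positivity) (by linarith) 4)


/-! ### The composition -/

/-- **KERNEL COMPOSITION (large-range variant of the tree's `prop91_large_of`).** Proposition 8.1 (restricted) ∧ Corollary 6.3 IN THE LARGE RANGE `X ≥ q²` ∧ the
upper bound for `x(s)` (S3) ∧ the separated bilinear mean value bound (S4) ∧ `#{N𝔞 = n} = τ(n,χ)`
(S5) ∧ `L(1,χ) ≥ π/√q` (S6) ∧ `MN = 1 + B₁ + B₂` (S7), together with the TREE's mollifier mean square
`sum_norm_shortInvSum_sq_le` and `Σ d(n)²/n ≤ (1 + log)⁴`, give **Proposition 9.1 (9.7) for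
`T ≥ q^65`, `log T ≥ (log q)²`** — VERBATIM the binder `stub_prop91_large` (S1) of SKELETON I6
14fb27945d1f8917 — with `C = √(C₁C₂) + 15000·C₃C₄√C₅`.
[cite: ConreyIwaniec2002, Proposition 9.1 (9.7), proof p. 20 L1–44] -/
theorem prop91_large_of'
    (h81 : ∃ C : ℝ, 0 < C ∧
      ∀ (q : ℕ) [NeZero q], 4 < q → Odd q → ∀ χ : DirichletCharacter ℂ q,
        χ.IsPrimitive → χ.IsQuadratic → χ.Odd →
          ∀ (K : Type) [Field K] [NumberField K],
            Module.finrank ℚ K = 2 → NumberField.discr K = -(q : ℤ) →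
              ∀ (ψ : ClassGroup (𝓞 K) →* ℂˣ) (T : ℝ) (S : Finset ℝ) (t' : ℝ → ℝ),
                (q : ℝ) ^ (65 : ℕ) ≤ T → Real.exp (Real.log q ^ (2 : ℕ)) ≤ T →
                  IsDyadicPointSet S T →
                  defectD K ψ q S t' ≤
                    C * (T * Real.log q ^ (7 : ℕ) + T * calL χ T * Real.log T ^ (4 : ℕ)))
    (h63 : ∃ C : ℝ, 0 < C ∧
      ∀ (q : ℕ) [NeZero q], 4 < q → ∀ χ : DirichletCharacter ℂ q,
        χ.IsPrimitive → χ.IsQuadratic → χ.Odd →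
          ∀ X Y : ℝ, (q : ℝ) ^ 2 ≤ X → 2 * X ≤ Y →
            ∑ n ∈ Finset.Icc ⌈X⌉₊ ⌊Y⌋₊, ‖divisorSumChar χ n‖ ^ 2 / (n : ℝ) ≤
              C * (calL χ Y * Real.log (Y / X) + Real.sqrt q * X ^ (-(9 / 20 : ℝ))))
    (hx : ∃ C : ℝ, 0 < C ∧ ∀ q : ℕ, 4 < q → ∀ t t' : ℝ, 2 ≤ t →
      ‖xQuot q (1 / 2 + t * I) (1 / 2 + t' * I)‖ ≤ C * (Real.log q + Real.log t))
    (hB : ∃ C : ℝ, 0 < C ∧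
      ∀ (N X M₁ M₂ N₁ N₂ : ℕ) (a b : ℕ → ℂ) (T : ℝ) (S : Finset ℝ),
        1 ≤ M₁ → M₂ ≤ N → 1 ≤ N₁ → N₂ ≤ N → 2 ≤ X → 0 < T → (N : ℝ) ≤ T →
          IsDyadicPointSet S T →
          ∑ t ∈ S, ‖∑ m ∈ Finset.Icc M₁ M₂, ∑ n ∈ Finset.Icc N₁ N₂,
              (if X < m * n then
                a m * (m : ℂ) ^ (-(1 / 2 + t * I)) * (b n * (n : ℂ) ^ (-(1 / 2 + t * I)))
               else 0)‖ ≤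
            C * T * (1 + Real.log N) * (1 + Real.log X) *
              Real.sqrt (∑ m ∈ Finset.Icc M₁ M₂, ‖a m‖ ^ 2 / m) *
              Real.sqrt (∑ n ∈ Finset.Icc N₁ N₂, ‖b n‖ ^ 2 / n))
    (hid : ∀ {q : ℕ} [NeZero q] {χ : DirichletCharacter ℂ q},
      χ.IsPrimitive → χ.IsQuadratic → χ.Odd →
        ∀ (K : Type) [Field K] [NumberField K],
          Module.finrank ℚ K = 2 → NumberField.discr K = -(q : ℤ) →
            ∀ {n : ℕ}, n ≠ 0 → (idealNormCount K n : ℝ) = ‖divisorSumChar χ n‖)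
    (hL : ∀ (q : ℕ) [NeZero q], 4 < q → ∀ χ : DirichletCharacter ℂ q,
      χ.IsPrimitive → χ.IsQuadratic → χ.Odd →
        ∀ (K : Type) [Field K] [NumberField K],
          Module.finrank ℚ K = 2 → NumberField.discr K = -(q : ℤ) →
            Real.pi / Real.sqrt q ≤ ‖χ.LFunction 1‖)
    (hMN : ∀ (K : Type) [Field K] [NumberField K] (ψ : ClassGroup (𝓞 K) →* ℂˣ) (q : ℕ),
      0 < q → ∀ s : ℂ,
        shortInvSum K ψ q s * shortLSum K ψ q s - 1 =
          (∑ m ∈ Finset.Icc (q ^ 2 + 1) (q ^ 4), ∑ n ∈ Finset.Icc 1 (q ^ 4),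
            if q ^ 4 < m * n then
              twistMoebius K (classGroupCharIdealHom ψ) m * (m : ℂ) ^ (-s) *
                (twistCount K (classGroupCharIdealHom ψ) n * (n : ℂ) ^ (-s))
            else 0) +
          (∑ m ∈ Finset.Icc 1 (q ^ 2), ∑ n ∈ Finset.Icc (q ^ 2 + 1) (q ^ 4),
            if q ^ 4 < m * n then
              twistMoebius K (classGroupCharIdealHom ψ) m * (m : ℂ) ^ (-s) *
                (twistCount K (classGroupCharIdealHom ψ) n * (n : ℂ) ^ (-s))
            else 0)) :
    ∃ C : ℝ, 0 < C ∧
    ∀ (q : ℕ) [NeZero q], 4 < q → Odd q → ∀ χ : DirichletCharacter ℂ q,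
      χ.IsPrimitive → χ.IsQuadratic → χ.Odd →
        ∀ (K : Type) [Field K] [NumberField K],
          Module.finrank ℚ K = 2 → NumberField.discr K = -(q : ℤ) →
            ∀ (ψ : ClassGroup (𝓞 K) →* ℂˣ) (T : ℝ) (S : Finset ℝ) (t' : ℝ → ℝ),
              (q : ℝ) ^ (65 : ℕ) ≤ T → Real.exp (Real.log q ^ (2 : ℕ)) ≤ T → IsDyadicPointSet S T →
                defectE K ψ q S t' ≤
                  C * (T * Real.log q ^ (6 : ℕ) +
                    T * Real.sqrt (calL χ T) * Real.log T ^ (2 : ℕ) * Real.log q ^ ((5 : ℝ) / 2)) := by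
  obtain ⟨C₁, hC₁, h81⟩ := h81
  obtain ⟨C₅, hC₅, h63⟩ := h63
  obtain ⟨C₃, hC₃, hx⟩ := hx
  obtain ⟨C₄, hC₄, hB⟩ := hB
  obtain ⟨C₂, hC₂, hM⟩ := sum_norm_shortInvSum_sq_le
  refine ⟨Real.sqrt (C₁ * C₂) + 15000 * C₃ * C₄ * Real.sqrt C₅, by positivity,
    fun q _ hq hodd χ hprim hquad hoddχ K _ _ h2 hdisc ψ T S t' hT hexpT hS => ?_⟩
  classical
  have hq0 : 0 < q := by omega
  obtain ⟨hℓ1, hℓLT, hq4T, hq_le_T, hT0, hℓ_le_LT, hLT1⟩ := range_numerics hq hT hexpT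
  have hqpos : (0 : ℝ) < q := by exact_mod_cast hq0
  have hT2 : (2 : ℝ) ≤ T := le_trans (by exact_mod_cast (by omega : 2 ≤ q)) hq_le_T
  obtain ⟨hL1q, hcLT, hcLq0, hcLq⟩ :=
    calL_numerics hq χ hq_le_T (hL q hq χ hprim hquad hoddχ K h2 hdisc)
  obtain ⟨hxpt, hXB⟩ := xQuot_segment_le hC₃ hx hq hT2 hS t' hℓ_le_LT hLT1
  obtain ⟨hA₁, hBn₁, hA₂, hBn₂, hrq⟩ :=
    coeff_sums_le' hq K ψ (hid hprim hquad hoddχ K h2 hdisc) hC₅ (h63 q hq χ hprim hquad hoddχ)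
  -- Proposition 8.1 and the mollifier mean square
  have hD := h81 q hq hodd χ hprim hquad hoddχ K h2 hdisc ψ T S t' hT hexpT hS
  have hSM := hM q hq hodd χ hprim hquad hoddχ K h2 hdisc ψ T S hq4T hS
  -- the separated bilinear bounds
  have hNT : ((q ^ 4 : ℕ) : ℝ) ≤ T := by push_cast; exact hq4T
  have hq2 : 2 ≤ q ^ 4 := by
    calc 2 ≤ 2 ^ 4 := by norm_num
      _ ≤ q ^ 4 := Nat.pow_le_pow_left (by omega) 4
  have hlog4 : Real.log ((q ^ 4 : ℕ) : ℝ) = 4 * Real.log q := by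
    push_cast; rw [Real.log_pow]; push_cast; ring
  have hSB₁ := hB (q ^ 4) (q ^ 4) (q ^ 2 + 1) (q ^ 4) 1 (q ^ 4)
    (twistMoebius K (classGroupCharIdealHom ψ)) (twistCount K (classGroupCharIdealHom ψ)) T S
    (Nat.le_add_left 1 _) le_rfl le_rfl le_rfl hq2 hT0 hNT hS
  have hSB₂ := hB (q ^ 4) (q ^ 4) 1 (q ^ 2) (q ^ 2 + 1) (q ^ 4)
    (twistMoebius K (classGroupCharIdealHom ψ)) (twistCount K (classGroupCharIdealHom ψ)) T S
    le_rfl (Nat.pow_le_pow_right hq0 (by norm_num)) (Nat.le_add_left 1 _) le_rfl hq2 hT0 hNT hS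
  rw [hlog4] at hSB₁ hSB₂
  -- `E ≤ √D √(Σ|M|²) + X (Σ|B₁| + Σ|B₂|)`
  have hE := defectE_le_diag_offdiag K ψ q S t' (C₃ * (Real.log q + Real.log (2 * T)))
    (fun t => hMN K ψ q hq0 (1 / 2 + t * I)) hxpt
  have hSB₁0 : 0 ≤ ∑ t ∈ S, ‖(∑ m ∈ Finset.Icc (q ^ 2 + 1) (q ^ 4), ∑ n ∈ Finset.Icc 1 (q ^ 4),
            if q ^ 4 < m * n then
              twistMoebius K (classGroupCharIdealHom ψ) m * (m : ℂ) ^ (-(1 / 2 + t * I)) *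
                (twistCount K (classGroupCharIdealHom ψ) n * (n : ℂ) ^ (-(1 / 2 + t * I)))
            else 0)‖ := Finset.sum_nonneg fun _ _ => norm_nonneg _
  have hSB₂0 : 0 ≤ ∑ t ∈ S, ‖(∑ m ∈ Finset.Icc 1 (q ^ 2), ∑ n ∈ Finset.Icc (q ^ 2 + 1) (q ^ 4),
            if q ^ 4 < m * n then
              twistMoebius K (classGroupCharIdealHom ψ) m * (m : ℂ) ^ (-(1 / 2 + t * I)) *
                (twistCount K (classGroupCharIdealHom ψ) n * (n : ℂ) ^ (-(1 / 2 + t * I)))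
            else 0)‖ := Finset.sum_nonneg fun _ _ => norm_nonneg _
  -- assemble
  exact prop91_algebra' hC₁ hC₂ hC₃ hC₄ hC₅ hT0.le hℓ1 hℓLT (norm_nonneg _) hqpos hL1q
    (by positivity) hrq hcLq0 hcLq hcLT hE hD hSM hXB hSB₁0 hSB₂0 hSB₁ hSB₂ hA₁ hBn₁ hA₂ hBn₂


/-- **PROPOSITION 9.1 FOR `T ≥ q^65`, `log T ≥ (log q)²`, FROM PROPOSITION 8.1 (same range) AND
COROLLARY 6.3 IN THE LARGE RANGE `X ≥ q²` (stub S4 of SKELETON I6c, registered signature).** "Let `S(T)` be a set of points satisfying (8.1)–(8.3) … Then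
`E(T) ≪ T(log q)^6 + Tℒ(T)^{1/2}(log T)²(log q)^{5/2}` (9.7) where the implied constant is absolute" —
here for `1`-spaced `S ⊂ (T,2T]` with `q^65 ≤ T` and `e^{(log q)²} ≤ T`, GIVEN (8.10) in that range
and (6.49) as typed; every other ingredient of the printed proof is a tree theorem. The conclusion
is the binder `h1` of `principalEstimate_of` (Proposition 9.2) verbatim.
[cite: ConreyIwaniec2002, Proposition 9.1 (9.7)] -/
theorem prop91_large_of_prop81_large_corollary63_large
    (h81 :
    ∃ C : ℝ, 0 < C ∧
    ∀ (q : ℕ) [NeZero q], 4 < q → Odd q → ∀ χ : DirichletCharacter ℂ q,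
      χ.IsPrimitive → χ.IsQuadratic → χ.Odd →
        ∀ (K : Type) [Field K] [NumberField K],
          Module.finrank ℚ K = 2 → NumberField.discr K = -(q : ℤ) →
            ∀ (ψ : ClassGroup (𝓞 K) →* ℂˣ) (T : ℝ) (S : Finset ℝ) (t' : ℝ → ℝ),
              (q : ℝ) ^ (65 : ℕ) ≤ T → Real.exp (Real.log q ^ (2 : ℕ)) ≤ T → IsDyadicPointSet S T →
                defectD K ψ q S t' ≤
                  C * (T * Real.log q ^ (7 : ℕ) + T * calL χ T * Real.log T ^ (4 : ℕ)))
    (h63 : ∃ C : ℝ, 0 < C ∧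
      ∀ (q : ℕ) [NeZero q], 4 < q → ∀ χ : DirichletCharacter ℂ q,
        χ.IsPrimitive → χ.IsQuadratic → χ.Odd →
          ∀ X Y : ℝ, (q : ℝ) ^ 2 ≤ X → 2 * X ≤ Y →
            ∑ n ∈ Finset.Icc ⌈X⌉₊ ⌊Y⌋₊, ‖divisorSumChar χ n‖ ^ 2 / (n : ℝ) ≤
              C * (calL χ Y * Real.log (Y / X) + Real.sqrt q * X ^ (-(9 / 20 : ℝ)))) :
    ∃ C : ℝ, 0 < C ∧
    ∀ (q : ℕ) [NeZero q], 4 < q → Odd q → ∀ χ : DirichletCharacter ℂ q,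
      χ.IsPrimitive → χ.IsQuadratic → χ.Odd →
        ∀ (K : Type) [Field K] [NumberField K],
          Module.finrank ℚ K = 2 → NumberField.discr K = -(q : ℤ) →
            ∀ (ψ : ClassGroup (𝓞 K) →* ℂˣ) (T : ℝ) (S : Finset ℝ) (t' : ℝ → ℝ),
              (q : ℝ) ^ (65 : ℕ) ≤ T → Real.exp (Real.log q ^ (2 : ℕ)) ≤ T → IsDyadicPointSet S T →
                defectE K ψ q S t' ≤
                  C * (T * Real.log q ^ (6 : ℕ) +
                    T * Real.sqrt (calL χ T) * Real.log T ^ (2 : ℕ) * Real.log q ^ ((5 : ℝ) / 2)) :=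
  prop91_large_of' h81 h63 norm_xQuot_le bilinear_hyperbolic_dyadic
    (fun hprim hquad hodd K _ _ h2 hdisc _ hn =>
      idealNormCount_eq_norm_divisorSumChar_of_quadratic hprim hquad hodd K h2 hdisc hn)
    (fun q _ hq χ hprim hquad hodd K _ _ h2 hdisc =>
      norm_LFunction_one_ge q hq χ hprim hquad hodd K h2 hdisc)
    (fun K _ _ ψ q hq s => shortInvSum_mul_shortLSum_sub_one K ψ q hq s)


end ConreyIwaniec2002

end Literature.NumberTheory.LFunctions

end
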